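import Summits.Langlands.Langlands.Theorems.IrreducibilityBySelfDualityReciprocityUpToIrreducibilityWeakExistenceAll
import Literature.NumberTheory.GaloisRepresentations.WeilLAdicCharacterProofs
import HarnessLib

/-!
# Stub D of line `Sketch` (crux `ReciprocityUpToIrreducibility`, item stmt-Langlands-14328) in rank one:
# the Satake half of weak existence W for EVERY algebraic Hecke character (wave N11, stub D)

Support file (closes nothing).  The accepted `…WeakExistenceAll` proves the Satake–Frobenius clause of
Buzzard–Gee's weak existence W (Conj. 3.2.2) for `GL_1` in the sector "`π` transforms by `χ₀ ∘ det`,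
`χ₀` of FINITE ORDER", from the `ℓ`-adic avatar of the Artin character of `χ₀`
(`exists_lAdic_of_isFiniteOrder_isOpen_ker`).  This file runs the same computation for EVERY
ALGEBRAIC Hecke character `θ` (type `A₀`) of EVERY number field, the Galois input being Weil's
theorem (1956; Serre 1968, Ch. II §2.8): the tree's PROVED
`HeckeCharacter.IsAlgebraic.exists_lAdic` — for `θ` algebraic and `ι : ℚ̄_ℓ ≃+* ℂ` there is
`r : Γ_K → GL_1(ℚ̄_ℓ)` which, at every `v ∤ ℓ` where `θ` is unramified, is unramified with
`char r(Frob_v^{arith}) = X - ι⁻¹(θ(ϖ_v))⁻¹`.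

* `rankOne_satakeAE_of_isAlgebraic` — for a cuspidal automorphic datum `π` of `GL_1(𝔸_K)`
  transforming by `θ ∘ det` with `θ` algebraic, Weil's `ℓ`-adic character `ρ` of `θ` is unramified
  almost everywhere and Satake–Frobenius compatible with `(π, ι)` at all but finitely many places
  (the places where `π` is ramified or which lie above `ℓ`): at an unramified place `v ∤ ℓ` of `π`,
  `θ` is unramified (`AutomorphicRepData.isUnramifiedAt_heckeCharacter_glOne`), the Satake parameter
  is `{θ(ϖ_v)}` (`AutomorphicRepData.exists_eq_singleton_of_hasSatakeParamAt_glOne`), and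
  `arithFrobPolyOfSatake ι q_v 1 {θ(ϖ_v)} = X - ι⁻¹(θ(ϖ_v))⁻¹` (`arithFrobPolyOfSatake_one`) is the
  Frobenius characteristic polynomial of `ρ` at `v` by Weil's theorem.
* `stub_rankOne_satakeAE_of_isAlgebraic` — the closed form registered in the skeleton (wave N11-D).

No definitions; std axioms; no named fact.
-/

noncomputable section

set_option linter.dupNamespace false -- project-wide option (lakefile weak.linter.dupNamespace); `Summit.Langlands.Langlands` is the mandated namespace

open scoped MatrixGroups Matrix NumberField Classical Polynomial
open Filter IsDedekindDomain Field Polynomial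
open Literature.NumberTheory.Automorphic Literature.NumberTheory.GaloisRepresentations
open Literature.NumberTheory.PAdicHodge
open Summit.Langlands

namespace Summit.Langlands.Langlands.Theorems.ReciprocityUpToIrreducibility

variable {K : Type} [Field K] [NumberField K] {ℓ : ℕ} [Fact ℓ.Prime]

/-- **The Satake half of stub W (weak existence) for `GL_1`, sector "algebraic Hecke character",
every number field.**  Let `π` be a cuspidal automorphic datum of `GL_1(𝔸_K)` transforming by
`θ ∘ det` with `θ` an ALGEBRAIC Hecke character (type `A₀`), `ℓ` a prime and `ι : ℚ̄_ℓ ≃+* ℂ`.  Then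
Weil's `ℓ`-adic character `ρ : Γ_K → GL_1(ℚ̄_ℓ)` of `θ` (`HeckeCharacter.IsAlgebraic.exists_lAdic`)
satisfies: (i) at every `v ∤ ℓ` where `θ` is unramified, `ρ` is unramified with
`char ρ(Frob_v^{arith}) = X - ι⁻¹(θ(ϖ_v))⁻¹`; (ii) `ρ` is unramified almost everywhere; (iii) `ρ` is
Satake–Frobenius compatible with `(π, ι)` at all but finitely many places.  For (iii): at a place
`v ∤ ℓ` where `π` has a Satake parameter `α` (all but finitely many, Flath), `θ` is unramified
(`AutomorphicRepData.isUnramifiedAt_heckeCharacter_glOne`), `α = {θ(ϖ_v)}`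
(`AutomorphicRepData.exists_eq_singleton_of_hasSatakeParamAt_glOne`) and
`arithFrobPolyOfSatake ι q_v 1 α = X - ι⁻¹(θ(ϖ_v))⁻¹` (`arithFrobPolyOfSatake_one`), which is (i);
(ii) follows from (iii).
[cite: Weil1956, §1–§2] [cite: SerreAbelianLadic1968, Ch. II §2.7–2.8]
[cite: BuzzardGeeLMS2014, Conj. 3.2.2 (n = 1)] -/
theorem rankOne_satakeAE_of_isAlgebraic (hcpt : isCompact_glFiniteIntegralLevel 1 K)
    (π : CuspidalAutomorphicRepData 1 K hcpt) {θ : HeckeCharacter K}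
    (hχ : ∀ (g : (AdelicGroupData.gl 1 K).Adelic), ∀ φ ∈ π.1.W,
      rightTranslation (AdelicGroupData.gl 1 K) g φ -
        ((θ (Matrix.GeneralLinearGroup.det g) : ℂˣ) : ℂ) • φ ∈ π.1.W')
    (halg : θ.IsAlgebraic) (ι : PadicAlgCl ℓ ≃+* ℂ) :
    ∃ ρ : FramedGaloisRep K (PadicAlgCl ℓ) 1,
      (∀ v : HeightOneSpectrum (𝓞 K), ((ℓ : ℕ) : 𝓞 K) ∉ v.asIdeal → θ.IsUnramifiedAt v →
        ρ.IsUnramifiedAt v ∧ ρ.HasFrobCharpolyAt v (X - C (ι.symm (θ.valueAtUniformizer v)⁻¹))) ∧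
      (∀ᶠ v : HeightOneSpectrum (𝓞 K) in cofinite, ρ.IsUnramifiedAt v) ∧
      ∀ᶠ v : HeightOneSpectrum (𝓞 K) in cofinite, SatakeFrobCompatibleAt ι π.1 ρ v := by
  classical
  obtain ⟨r, hr⟩ := halg.exists_lAdic ι
  have hunrπ : ∀ᶠ v : HeightOneSpectrum (𝓞 K) in cofinite, π.1.IsUnramifiedAt v :=
    π.1.hasSatakeParamAt_cofinite_holds
  -- Satake–Frobenius compatibility at the unramified places of `π` away from `ℓ`
  have key : ∀ᶠ v : HeightOneSpectrum (𝓞 K) in cofinite, SatakeFrobCompatibleAt ι π.1 r v := by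
    filter_upwards [hunrπ, FramedGaloisRep.eventually_natCast_not_mem K ℓ] with v hv hvℓ
    obtain ⟨α, hα⟩ := hv
    have hur : θ.IsUnramifiedAt v := π.1.isUnramifiedAt_heckeCharacter_glOne hχ hα
    refine ⟨α, hα, (hr v hvℓ hur).1, ?_⟩
    obtain ⟨ϖ, hϖ, rfl⟩ := π.1.exists_eq_singleton_of_hasSatakeParamAt_glOne hχ hα
    have hc : ((θ (localUnits v ϖ) : ℂˣ) : ℂ) = θ.valueAtUniformizer v := by
      rw [← HeckeCharacter.localComponent_eq_valueAtUniformizer hur hϖ,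
        HeckeCharacter.localComponent_apply]
    rw [arithFrobPolyOfSatake_one, Multiset.map_singleton, Multiset.prod_singleton, hc]
    exact (hr v hvℓ hur).2
  exact ⟨r, hr, key.mono fun v ⟨_, _, h, _⟩ => h, key⟩

/-- **Closed form of `rankOne_satakeAE_of_isAlgebraic`** (all binders explicit, in the order
`K, ℓ, hcpt, π, θ`): the shape in which this sector is registered as a stub of the crux
(`stub_rankOne_satakeAE_of_isAlgebraic`, wave N11-D) — the Satake half of Buzzard–Gee's weak
existence W in rank one for every algebraic Hecke character over every number field, `ρ` being
Weil's `ℓ`-adic character of `θ`.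
[cite: Weil1956, §1–§2] [cite: SerreAbelianLadic1968, Ch. II §2.7–2.8]
[cite: BuzzardGeeLMS2014, Conj. 3.2.2 (n = 1)] -/
theorem stub_rankOne_satakeAE_of_isAlgebraic :
    ∀ (K : Type) [Field K] [NumberField K] (ℓ : ℕ) [Fact ℓ.Prime]
      (hcpt : isCompact_glFiniteIntegralLevel 1 K) (π : CuspidalAutomorphicRepData 1 K hcpt)
      (θ : HeckeCharacter K),
      (∀ (g : (AdelicGroupData.gl 1 K).Adelic), ∀ φ ∈ π.1.W,
        rightTranslation (AdelicGroupData.gl 1 K) g φ -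
          ((θ (Matrix.GeneralLinearGroup.det g) : ℂˣ) : ℂ) • φ ∈ π.1.W') →
      θ.IsAlgebraic → ∀ ι : PadicAlgCl ℓ ≃+* ℂ,
        ∃ ρ : FramedGaloisRep K (PadicAlgCl ℓ) 1,
          (∀ v : HeightOneSpectrum (𝓞 K), ((ℓ : ℕ) : 𝓞 K) ∉ v.asIdeal → θ.IsUnramifiedAt v →
            ρ.IsUnramifiedAt v ∧ ρ.HasFrobCharpolyAt v (X - C (ι.symm (θ.valueAtUniformizer v)⁻¹))) ∧
          (∀ᶠ v : HeightOneSpectrum (𝓞 K) in cofinite, ρ.IsUnramifiedAt v) ∧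
          ∀ᶠ v : HeightOneSpectrum (𝓞 K) in cofinite, SatakeFrobCompatibleAt ι π.1 ρ v := by
  intro _ _ _ _ _ hcpt π _ hχ halg ι
  exact rankOne_satakeAE_of_isAlgebraic hcpt π hχ halg ι

end Summit.Langlands.Langlands.Theorems.ReciprocityUpToIrreducibility

end
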